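import Summits.ResolutionOfSingularities.ResolutionOfSingularities.Theorems.MarkedTransferCampaignW46FiniteExitBound
import HarnessLib

/-!
# [OURS · L1 W4.6 rungs (i-a)′ / (iii)] Finite §2.1-permissible sequences: the EMPTY run and PREPENDING one permissible
# blow-up (`FinPermissibleRun.nil` / `FinPermissibleRun.cons`) — proof-device API for constructing runs
# (cell res-hironaka, LADDER-RESOLUTION rung L, D-0089; slot W4.6; seat res-D-brk-2 (CONVERT, L object on the s46 desk's
# terms); host route MarkedTransfer, `--supports stmt-ResolutionOfSingularities-16155 --as helper`)

HONEST FRAMING. Nothing here is a statement of H. Hironaka's manuscript (2017-03-23, [Hironaka2017]) and nothing here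
asserts that any statement of it holds. Everything is OURS: pure bookkeeping over res-L1-s46-pv-1's résumé-free sequence
type `CampaignW46.FinPermissibleRun` (`…FiniteExitBound.lean`, p485314/p488284) and the typed row-001 carriers
(`AmbientDatum`, `IdealExponent`, `IsPermissibleCentre`, `transform`). AI review is weaker than expert review. No `sorry`;
axioms standard.

## Why this file

Every EXISTENCE statement about permissible sequences (the non-vacuity witness of rung (i-a)′, the attained length
`⌊n/p⌋` of the cusp staircase in the companion `…CuspStaircaseClimb.lean`, longer towers for the (VAC) clause of
`FinLocalExitBound`) has to BUILD a term of `FinPermissibleRun p K`, whose data are ℕ-indexed dependent families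
(`E k : IdealExponent (A k).Z`, `π k : (A (k+1)).Z ⟶ (A k).Z`). This file does the dependent bookkeeping ONCE:

* `FinPermissibleRun.nil A E hE` — the run of length `0` at a standard state `(A, E)` (padding: constant data, identity
  maps, empty centres; nothing below `len` is constrained).
* `FinPermissibleRun.cons r A₀ E₀ D₀ π₀ …` — PREPEND one permissible blow-up `π₀ : (r.A 0).Z ⟶ A₀.Z` (centre `D₀`
  permissible for the standard `E₀`, same base field, `IsBlowup π₀ 𝓘_{D₀}`, `r.E 0 = E₀.transform π₀ D₀`) to a finite run
  `r`: a run of length `r.len + 1` whose stage `0` is `(A₀, E₀)` and whose stage `k + 1` is `r`'s stage `k`. The blow-up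
  is taken to LAND IN `r.A 0` (no equation between ambient data is transported), which is what an inductive construction
  «blow up once, then recurse on the new state» produces after `subst`.
* `rfl`-lemmas for all data fields, `cons_down_succ` / `cons_down_succ_apply`
  (`(cons …).down (m+1) = r.down m ≫ π₀`), `cons_regime` (a regime holding at `(A₀, E₀)` and along `r` holds along the
  cons), `cons_over` (if all centres of `r` lie over a point `x₁` with `π₀ x₁ = x₀ ∈ D₀`, all centres of the cons lie over
  `x₀`).

## References

* res-L1-s46-pv-1, `…PermissibleReduction.lean` / `…FiniteExitBound.lean` (the sequence types; DESIGN POINT (PAD));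
  res-L1-type-o1 RUNG-MAP-W46.md §RUNG (i-a)′.
* H. Hironaka, ms. 2017-03-23, §2.1 p.4 l.35–39, Def. 2.1 p.5 l.2–3 — scope only, under adjudication, not cited as
  fact. [Hironaka2017]
-/

noncomputable section

set_option linter.dupNamespace false -- mandated namespace of this single-conjunct summit

open CategoryTheory AlgebraicGeometry TopologicalSpace

namespace Summit.ResolutionOfSingularities.ResolutionOfSingularities.Theorems

namespace CampaignW46

open Literature.AlgebraicGeometry.Resolution
open Literature.AlgebraicGeometry.Hironaka2017.S02Preliminaries
open Scheme.IdealSheafData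

universe u

variable {p : ℕ} [Fact p.Prime] {K : Type u} [Field K] [CharP K p]

namespace FinPermissibleRun

/-! ## The empty run -/

/-- [OURS · L1 W4.6] NOT a statement of the manuscript. **The §2.1-permissible sequence of length `0` at a standard state
`(A, E)`**: all stages equal `(A, E)`, all maps identities, all centres empty (inert padding beyond `len = 0`, DESIGN
POINT (PAD) of `FinPermissibleRun`). [folklore] -/
def nil (A : AmbientDatum p K) (E : IdealExponent A.Z) (hE : E.IsStandard) : FinPermissibleRun p K where
  len := 0
  A := fun _ => A
  E := fun _ => E
  D := fun _ => ⊥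
  π := fun _ => 𝟙 A.Z
  standard := fun _ _ => hE
  permissible := fun k hk => absurd hk (Nat.not_lt_zero k)
  hom_eq := fun k hk => absurd hk (Nat.not_lt_zero k)
  blowup := fun k hk => absurd hk (Nat.not_lt_zero k)
  E_succ := fun k hk => absurd hk (Nat.not_lt_zero k)

section Nil

/-- [folklore] -/
@[simp] theorem nil_len (A : AmbientDatum p K) (E : IdealExponent A.Z) (hE : E.IsStandard) : (nil A E hE).len = 0 := rfl

/-- [folklore] -/
@[simp] theorem nil_A (A : AmbientDatum p K) (E : IdealExponent A.Z) (hE : E.IsStandard) (k : ℕ) :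
    (nil A E hE).A k = A := rfl

/-- [folklore] -/
@[simp] theorem nil_E (A : AmbientDatum p K) (E : IdealExponent A.Z) (hE : E.IsStandard) (k : ℕ) :
    (nil A E hE).E k = E := rfl

/-- A regime holding at `(A, E)` holds at every stage of the empty run. [folklore] -/
theorem nil_regime (A : AmbientDatum p K) (E : IdealExponent A.Z) (hE : E.IsStandard) {Rg : Regime p K} (h : Rg A E) :
    ∀ k, k ≤ (nil A E hE).len → Rg ((nil A E hE).A k) ((nil A E hE).E k) :=
  fun _ _ => h

end Nil

/-! ## Prepending one permissible blow-up -/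

/-- The ambient sequence of a cons: `A₀` at stage `0`, then `A`. [folklore] -/
def consA (A₀ : AmbientDatum p K) (A : ℕ → AmbientDatum p K) : ℕ → AmbientDatum p K
  | 0 => A₀
  | k + 1 => A k

/-- The exponent sequence of a cons. [folklore] -/
def consE (A₀ : AmbientDatum p K) (E₀ : IdealExponent A₀.Z) (A : ℕ → AmbientDatum p K)
    (E : ∀ k, IdealExponent (A k).Z) : ∀ k, IdealExponent (consA A₀ A k).Z
  | 0 => E₀
  | k + 1 => E k

/-- The centre sequence of a cons. [folklore] -/
def consD (A₀ : AmbientDatum p K) (D₀ : Closeds A₀.Z) (A : ℕ → AmbientDatum p K)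
    (D : ∀ k, Closeds (A k).Z) : ∀ k, Closeds (consA A₀ A k).Z
  | 0 => D₀
  | k + 1 => D k

/-- The blow-up sequence of a cons: `π₀ : (A 0).Z ⟶ A₀.Z` at stage `0`, then `π`. [folklore] -/
def consπ (A₀ : AmbientDatum p K) (A : ℕ → AmbientDatum p K) (π₀ : (A 0).Z ⟶ A₀.Z)
    (π : ∀ k, (A (k + 1)).Z ⟶ (A k).Z) : ∀ k, (consA A₀ A (k + 1)).Z ⟶ (consA A₀ A k).Z
  | 0 => π₀
  | k + 1 => π k

/-- [OURS · L1 W4.6] NOT a statement of the manuscript. **Prepending one §2.1-permissible blow-up to a finite permissible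
sequence.** Data: a finite run `r`; a standard state `(A₀, E₀)`; a centre `D₀` permissible for `E₀` (§2.1: irreducible,
smooth over `K`, inside `Sing(E₀)`); a blowing up `π₀ : (r.A 0).Z ⟶ A₀.Z` of `A₀.Z` along the reduced ideal of `D₀`
LANDING IN `r`'s stage `0`, over the same base field (`(r.A 0).hom = π₀ ≫ A₀.hom`), with `r.E 0` the Def. 2.1 transform
of `E₀`. Result: the run `(A₀, E₀) → r` of length `r.len + 1`. [folklore] -/
def cons (r : FinPermissibleRun p K) (A₀ : AmbientDatum p K) (E₀ : IdealExponent A₀.Z) (D₀ : Closeds A₀.Z)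
    (π₀ : (r.A 0).Z ⟶ A₀.Z) (hE₀ : E₀.IsStandard) (hD₀ : E₀.IsPermissibleCentre A₀.hom D₀)
    (hhom : (r.A 0).hom = π₀ ≫ A₀.hom) (hπ₀ : IsBlowup π₀ (vanishingIdeal D₀))
    (hsucc : r.E 0 = E₀.transform π₀ D₀) : FinPermissibleRun p K where
  len := r.len + 1
  A := consA A₀ r.A
  E := consE A₀ E₀ r.A r.E
  D := consD A₀ D₀ r.A r.D
  π := consπ A₀ r.A π₀ r.π
  standard k hk := by
    cases k with
    | zero => exact hE₀
    | succ k => exact r.standard k (Nat.le_of_succ_le_succ hk)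
  permissible k hk := by
    cases k with
    | zero => exact hD₀
    | succ k => exact r.permissible k (Nat.lt_of_succ_lt_succ hk)
  hom_eq k hk := by
    cases k with
    | zero => exact hhom
    | succ k => exact r.hom_eq k (Nat.lt_of_succ_lt_succ hk)
  blowup k hk := by
    cases k with
    | zero => exact hπ₀
    | succ k => exact r.blowup k (Nat.lt_of_succ_lt_succ hk)
  E_succ k hk := by
    cases k with
    | zero => exact hsucc
    | succ k => exact r.E_succ k (Nat.lt_of_succ_lt_succ hk)

section Cons

/-- [folklore] -/
@[simp] theorem cons_len (r : FinPermissibleRun p K) (A₀ : AmbientDatum p K) (E₀ : IdealExponent A₀.Z)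
    (D₀ : Closeds A₀.Z) (π₀ : (r.A 0).Z ⟶ A₀.Z) (hE₀ : E₀.IsStandard) (hD₀ : E₀.IsPermissibleCentre A₀.hom D₀)
    (hhom : (r.A 0).hom = π₀ ≫ A₀.hom) (hπ₀ : IsBlowup π₀ (vanishingIdeal D₀)) (hsucc : r.E 0 = E₀.transform π₀ D₀)
    : (r.cons A₀ E₀ D₀ π₀ hE₀ hD₀ hhom hπ₀ hsucc).len = r.len + 1 := rfl

/-- [folklore] -/
@[simp] theorem cons_A_zero (r : FinPermissibleRun p K) (A₀ : AmbientDatum p K) (E₀ : IdealExponent A₀.Z)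
    (D₀ : Closeds A₀.Z) (π₀ : (r.A 0).Z ⟶ A₀.Z) (hE₀ : E₀.IsStandard) (hD₀ : E₀.IsPermissibleCentre A₀.hom D₀)
    (hhom : (r.A 0).hom = π₀ ≫ A₀.hom) (hπ₀ : IsBlowup π₀ (vanishingIdeal D₀)) (hsucc : r.E 0 = E₀.transform π₀ D₀)
    : (r.cons A₀ E₀ D₀ π₀ hE₀ hD₀ hhom hπ₀ hsucc).A 0 = A₀ := rfl

/-- [folklore] -/
@[simp] theorem cons_A_succ (r : FinPermissibleRun p K) (A₀ : AmbientDatum p K) (E₀ : IdealExponent A₀.Z)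
    (D₀ : Closeds A₀.Z) (π₀ : (r.A 0).Z ⟶ A₀.Z) (hE₀ : E₀.IsStandard) (hD₀ : E₀.IsPermissibleCentre A₀.hom D₀)
    (hhom : (r.A 0).hom = π₀ ≫ A₀.hom) (hπ₀ : IsBlowup π₀ (vanishingIdeal D₀)) (hsucc : r.E 0 = E₀.transform π₀ D₀)
    (k : ℕ) : (r.cons A₀ E₀ D₀ π₀ hE₀ hD₀ hhom hπ₀ hsucc).A (k + 1) = r.A k := rfl

/-- [folklore] -/
@[simp] theorem cons_E_zero (r : FinPermissibleRun p K) (A₀ : AmbientDatum p K) (E₀ : IdealExponent A₀.Z)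
    (D₀ : Closeds A₀.Z) (π₀ : (r.A 0).Z ⟶ A₀.Z) (hE₀ : E₀.IsStandard) (hD₀ : E₀.IsPermissibleCentre A₀.hom D₀)
    (hhom : (r.A 0).hom = π₀ ≫ A₀.hom) (hπ₀ : IsBlowup π₀ (vanishingIdeal D₀)) (hsucc : r.E 0 = E₀.transform π₀ D₀)
    : (r.cons A₀ E₀ D₀ π₀ hE₀ hD₀ hhom hπ₀ hsucc).E 0 = E₀ := rfl

/-- [folklore] -/
@[simp] theorem cons_E_succ (r : FinPermissibleRun p K) (A₀ : AmbientDatum p K) (E₀ : IdealExponent A₀.Z)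
    (D₀ : Closeds A₀.Z) (π₀ : (r.A 0).Z ⟶ A₀.Z) (hE₀ : E₀.IsStandard) (hD₀ : E₀.IsPermissibleCentre A₀.hom D₀)
    (hhom : (r.A 0).hom = π₀ ≫ A₀.hom) (hπ₀ : IsBlowup π₀ (vanishingIdeal D₀)) (hsucc : r.E 0 = E₀.transform π₀ D₀)
    (k : ℕ) : (r.cons A₀ E₀ D₀ π₀ hE₀ hD₀ hhom hπ₀ hsucc).E (k + 1) = r.E k := rfl

/-- [folklore] -/
@[simp] theorem cons_D_zero (r : FinPermissibleRun p K) (A₀ : AmbientDatum p K) (E₀ : IdealExponent A₀.Z)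
    (D₀ : Closeds A₀.Z) (π₀ : (r.A 0).Z ⟶ A₀.Z) (hE₀ : E₀.IsStandard) (hD₀ : E₀.IsPermissibleCentre A₀.hom D₀)
    (hhom : (r.A 0).hom = π₀ ≫ A₀.hom) (hπ₀ : IsBlowup π₀ (vanishingIdeal D₀)) (hsucc : r.E 0 = E₀.transform π₀ D₀)
    : (r.cons A₀ E₀ D₀ π₀ hE₀ hD₀ hhom hπ₀ hsucc).D 0 = D₀ := rfl

/-- [folklore] -/
@[simp] theorem cons_D_succ (r : FinPermissibleRun p K) (A₀ : AmbientDatum p K) (E₀ : IdealExponent A₀.Z)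
    (D₀ : Closeds A₀.Z) (π₀ : (r.A 0).Z ⟶ A₀.Z) (hE₀ : E₀.IsStandard) (hD₀ : E₀.IsPermissibleCentre A₀.hom D₀)
    (hhom : (r.A 0).hom = π₀ ≫ A₀.hom) (hπ₀ : IsBlowup π₀ (vanishingIdeal D₀)) (hsucc : r.E 0 = E₀.transform π₀ D₀)
    (k : ℕ) : (r.cons A₀ E₀ D₀ π₀ hE₀ hD₀ hhom hπ₀ hsucc).D (k + 1) = r.D k := rfl

/-- [folklore] -/
@[simp] theorem cons_π_zero (r : FinPermissibleRun p K) (A₀ : AmbientDatum p K) (E₀ : IdealExponent A₀.Z)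
    (D₀ : Closeds A₀.Z) (π₀ : (r.A 0).Z ⟶ A₀.Z) (hE₀ : E₀.IsStandard) (hD₀ : E₀.IsPermissibleCentre A₀.hom D₀)
    (hhom : (r.A 0).hom = π₀ ≫ A₀.hom) (hπ₀ : IsBlowup π₀ (vanishingIdeal D₀)) (hsucc : r.E 0 = E₀.transform π₀ D₀)
    : (r.cons A₀ E₀ D₀ π₀ hE₀ hD₀ hhom hπ₀ hsucc).π 0 = π₀ := rfl

/-- [folklore] -/
@[simp] theorem cons_π_succ (r : FinPermissibleRun p K) (A₀ : AmbientDatum p K) (E₀ : IdealExponent A₀.Z)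
    (D₀ : Closeds A₀.Z) (π₀ : (r.A 0).Z ⟶ A₀.Z) (hE₀ : E₀.IsStandard) (hD₀ : E₀.IsPermissibleCentre A₀.hom D₀)
    (hhom : (r.A 0).hom = π₀ ≫ A₀.hom) (hπ₀ : IsBlowup π₀ (vanishingIdeal D₀)) (hsucc : r.E 0 = E₀.transform π₀ D₀)
    (k : ℕ) : (r.cons A₀ E₀ D₀ π₀ hE₀ hD₀ hhom hπ₀ hsucc).π (k + 1) = r.π k := rfl

/-- [folklore] -/
@[simp] theorem cons_down_zero (r : FinPermissibleRun p K) (A₀ : AmbientDatum p K) (E₀ : IdealExponent A₀.Z)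
    (D₀ : Closeds A₀.Z) (π₀ : (r.A 0).Z ⟶ A₀.Z) (hE₀ : E₀.IsStandard) (hD₀ : E₀.IsPermissibleCentre A₀.hom D₀)
    (hhom : (r.A 0).hom = π₀ ≫ A₀.hom) (hπ₀ : IsBlowup π₀ (vanishingIdeal D₀)) (hsucc : r.E 0 = E₀.transform π₀ D₀)
    : (r.cons A₀ E₀ D₀ π₀ hE₀ hD₀ hhom hπ₀ hsucc).down 0 = 𝟙 A₀.Z := rfl

/-- **The composites of a cons**: `Z_{m+1} ⟶ Z_0` of the cons is `Z′_m ⟶ Z′_0 = (r.A 0).Z` of `r` followed by `π₀`.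
[folklore] -/
theorem cons_down_succ (r : FinPermissibleRun p K) (A₀ : AmbientDatum p K) (E₀ : IdealExponent A₀.Z)
    (D₀ : Closeds A₀.Z) (π₀ : (r.A 0).Z ⟶ A₀.Z) (hE₀ : E₀.IsStandard) (hD₀ : E₀.IsPermissibleCentre A₀.hom D₀)
    (hhom : (r.A 0).hom = π₀ ≫ A₀.hom) (hπ₀ : IsBlowup π₀ (vanishingIdeal D₀)) (hsucc : r.E 0 = E₀.transform π₀ D₀)
    : ∀ m : ℕ, (r.cons A₀ E₀ D₀ π₀ hE₀ hD₀ hhom hπ₀ hsucc).down (m + 1) = r.down m ≫ π₀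
  | 0 => (Category.comp_id π₀).trans (Category.id_comp π₀).symm
  | m + 1 => (congrArg (fun g => r.π m ≫ g) (cons_down_succ r A₀ E₀ D₀ π₀ hE₀ hD₀ hhom hπ₀ hsucc m)).trans (Category.assoc _ _ _).symm

/-- Pointwise form of `cons_down_succ`. [folklore] -/
theorem cons_down_succ_apply (r : FinPermissibleRun p K) (A₀ : AmbientDatum p K) (E₀ : IdealExponent A₀.Z)
    (D₀ : Closeds A₀.Z) (π₀ : (r.A 0).Z ⟶ A₀.Z) (hE₀ : E₀.IsStandard) (hD₀ : E₀.IsPermissibleCentre A₀.hom D₀)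
    (hhom : (r.A 0).hom = π₀ ≫ A₀.hom) (hπ₀ : IsBlowup π₀ (vanishingIdeal D₀)) (hsucc : r.E 0 = E₀.transform π₀ D₀)
    (m : ℕ) (y : (r.A m).Z) :
    (r.cons A₀ E₀ D₀ π₀ hE₀ hD₀ hhom hπ₀ hsucc).down (m + 1) y = π₀ (r.down m y) := by
  have h2 : (r.cons A₀ E₀ D₀ π₀ hE₀ hD₀ hhom hπ₀ hsucc).down (m + 1) y = (r.down m ≫ π₀) y :=
    congrArg (fun f : (r.A m).Z ⟶ A₀.Z => f y) (r.cons_down_succ A₀ E₀ D₀ π₀ hE₀ hD₀ hhom hπ₀ hsucc m)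
  exact h2.trans (Scheme.Hom.comp_apply _ _ _)

/-- **Regimes along a cons**: a regime holding at `(A₀, E₀)` and at every stage `k ≤ r.len` of `r` holds at every stage
`k ≤ r.len + 1` of the cons. [folklore] -/
theorem cons_regime (r : FinPermissibleRun p K) (A₀ : AmbientDatum p K) (E₀ : IdealExponent A₀.Z)
    (D₀ : Closeds A₀.Z) (π₀ : (r.A 0).Z ⟶ A₀.Z) (hE₀ : E₀.IsStandard) (hD₀ : E₀.IsPermissibleCentre A₀.hom D₀)
    (hhom : (r.A 0).hom = π₀ ≫ A₀.hom) (hπ₀ : IsBlowup π₀ (vanishingIdeal D₀)) (hsucc : r.E 0 = E₀.transform π₀ D₀)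
    {Rg : Regime p K} (h0 : Rg A₀ E₀) (hr : ∀ k, k ≤ r.len → Rg (r.A k) (r.E k)) :
    ∀ k, k ≤ (r.cons A₀ E₀ D₀ π₀ hE₀ hD₀ hhom hπ₀ hsucc).len →
      Rg ((r.cons A₀ E₀ D₀ π₀ hE₀ hD₀ hhom hπ₀ hsucc).A k) ((r.cons A₀ E₀ D₀ π₀ hE₀ hD₀ hhom hπ₀ hsucc).E k)
  | 0, _ => h0
  | k + 1, hk => hr k (Nat.le_of_succ_le_succ hk)

/-- **Centres over a base point along a cons**: if every centre `D′_m`, `m < r.len`, of `r` meets the fibre of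
`Z′_m ⟶ Z′_0` over a point `x₁` with `π₀ x₁ = x₀ ∈ D₀`, then every centre of the cons (`m < r.len + 1`) meets the fibre
over `x₀`. [folklore] -/
theorem cons_over (r : FinPermissibleRun p K) (A₀ : AmbientDatum p K) (E₀ : IdealExponent A₀.Z)
    (D₀ : Closeds A₀.Z) (π₀ : (r.A 0).Z ⟶ A₀.Z) (hE₀ : E₀.IsStandard) (hD₀ : E₀.IsPermissibleCentre A₀.hom D₀)
    (hhom : (r.A 0).hom = π₀ ≫ A₀.hom) (hπ₀ : IsBlowup π₀ (vanishingIdeal D₀)) (hsucc : r.E 0 = E₀.transform π₀ D₀)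
    {x₀ : A₀.Z} {x₁ : (r.A 0).Z} (hx₀ : x₀ ∈ (D₀ : Set A₀.Z)) (hx₁ : π₀ x₁ = x₀)
    (hr : ∀ m, m < r.len → ∃ y ∈ (r.D m : Set (r.A m).Z), r.down m y = x₁) :
    ∀ m, m < (r.cons A₀ E₀ D₀ π₀ hE₀ hD₀ hhom hπ₀ hsucc).len →
      ∃ y ∈ ((r.cons A₀ E₀ D₀ π₀ hE₀ hD₀ hhom hπ₀ hsucc).D m : Set _),
        (r.cons A₀ E₀ D₀ π₀ hE₀ hD₀ hhom hπ₀ hsucc).down m y = x₀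
  | 0, _ => ⟨x₀, hx₀, rfl⟩
  | m + 1, hm => by
    obtain ⟨y, hy, hyx⟩ := hr m (Nat.lt_of_succ_lt_succ hm)
    refine ⟨y, hy, ?_⟩
    rw [cons_down_succ_apply, hyx, hx₁]

end Cons

end FinPermissibleRun

end CampaignW46

end Summit.ResolutionOfSingularities.ResolutionOfSingularities.Theorems

end
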